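import Mathlib

/-!
# Crux `HilbertIntegralOverconvergentIsCongruence` (stmt-Langlands-8485), line `Sketch-ideate-r1-k1`, RESHAPE 16 (§ T):
# registered stub T12 `stub_counts`

Combinatorics of the Siegel count: the total-degree window and the monomial count.
-/

set_option linter.dupNamespace false

noncomputable section

namespace Summit.Langlands.Langlands.Theorems.HilbertIntegralOverconvergentIsCongruence

open scoped NumberField

/-- Lattice-point count of the total-degree window: `{n : Fin d →₀ ℕ | ∑ j, n j < N}` is finite of
cardinality at most `N ^ d`, since `n ↦ ⇑n` injects it into the functions `Fin d → ℕ` with all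
values `< N` (each coordinate is at most the total degree). [folklore] -/
theorem cnt_window (d N : ℕ) :
    {n : Fin d →₀ ℕ | ∑ j, n j < N}.Finite ∧ {n : Fin d →₀ ℕ | ∑ j, n j < N}.ncard ≤ N ^ d := by
  have hmaps : Set.MapsTo (fun n : Fin d →₀ ℕ => (⇑n : Fin d → ℕ)) {n : Fin d →₀ ℕ | ∑ j, n j < N}
      ((Fintype.piFinset fun _ : Fin d => Finset.range N : Finset (Fin d → ℕ)) :
        Set (Fin d → ℕ)) := by
    intro n hn
    rw [Set.mem_setOf_eq] at hn
    rw [Finset.mem_coe, Fintype.mem_piFinset]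
    intro j
    exact Finset.mem_range.2 (lt_of_le_of_lt
      (Finset.single_le_sum (fun i _ => Nat.zero_le (n i)) (Finset.mem_univ j)) hn)
  have hinj : Set.InjOn (fun n : Fin d →₀ ℕ => (⇑n : Fin d → ℕ)) {n : Fin d →₀ ℕ | ∑ j, n j < N} :=
    DFunLike.coe_injective.injOn
  refine ⟨Set.Finite.of_finite_image ((Finset.finite_toSet
    (Fintype.piFinset fun _ : Fin d => Finset.range N)).subset hmaps.image_subset) hinj, ?_⟩
  calc Set.ncard {n : Fin d →₀ ℕ | ∑ j, n j < N}
        ≤ Set.ncard ((Fintype.piFinset fun _ : Fin d => Finset.range N : Finset (Fin d → ℕ)) :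
            Set (Fin d → ℕ)) :=
          Set.ncard_le_ncard_of_injOn _ (fun n hn => hmaps hn) hinj (Finset.finite_toSet _)
    _ = N ^ d := by
          rw [Set.ncard_coe_finset, Fintype.card_piFinset]
          simp

/-- Stars and bars: the number of degree-`m` monomials in `d + 1` variables is
`#Sym (Fin (d+1)) m = C(d + m, d)`. [folklore] -/
theorem cnt_card_sym (d m : ℕ) : Fintype.card (Sym (Fin (d + 1)) m) = (d + m).choose d := by
  rw [Sym.card_sym_eq_choose, Fintype.card_fin, show d + 1 + m - 1 = d + m by omega]
  exact Nat.choose_symm_add.symm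

/-- The monomial count `∑_{j<D} #Sym (Fin (d+1)) (D-j)` rewritten with binomial
coefficients. [folklore] -/
theorem cnt_sum_eq (d D : ℕ) :
    ∑ j ∈ Finset.range D, Fintype.card (Sym (Fin (d + 1)) (D - j)) =
      ∑ j ∈ Finset.range D, (d + (D - j)).choose d :=
  Finset.sum_congr rfl fun j _ => cnt_card_sym d (D - j)

/-- Lower bound for the monomial count: keeping only the indices `j ≤ H` (for `H < D`) and bounding
each of these `H + 1` terms below by the smallest one gives
`(H + 1) · C(d + (D - H), d) ≤ ∑_{j<D} C(d + (D-j), d)`. [folklore] -/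
theorem cnt_sum_lower (d D H : ℕ) (hH : H < D) :
    (H + 1) * (d + (D - H)).choose d ≤ ∑ j ∈ Finset.range D, (d + (D - j)).choose d := by
  calc (H + 1) * (d + (D - H)).choose d
        = ∑ _j ∈ Finset.range (H + 1), (d + (D - H)).choose d := by
          rw [Finset.sum_const, Finset.card_range, smul_eq_mul]
    _ ≤ ∑ j ∈ Finset.range (H + 1), (d + (D - j)).choose d := by
          refine Finset.sum_le_sum fun j hj => ?_
          rw [Finset.mem_range] at hj
          exact Nat.choose_le_choose d (by omega)
    _ ≤ ∑ j ∈ Finset.range D, (d + (D - j)).choose d :=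
          Finset.sum_le_sum_of_subset (Finset.range_subset_range.2 (by omega))

/-- Upper bound for the monomial count: each of the `D` terms satisfies
`C(d + (D-j), d) ≤ (d + (D-j))^d ≤ ((d+1) D)^d` for `1 ≤ D`, so
`∑_{j<D} C(d + (D-j), d) ≤ (d+1)^d · D^(d+1)`. [folklore] -/
theorem cnt_sum_upper (d D : ℕ) (hD : 1 ≤ D) :
    ∑ j ∈ Finset.range D, (d + (D - j)).choose d ≤ (d + 1) ^ d * D ^ (d + 1) := by
  calc ∑ j ∈ Finset.range D, (d + (D - j)).choose d
        ≤ ∑ _j ∈ Finset.range D, ((d + 1) * D) ^ d := by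
          refine Finset.sum_le_sum fun j _ => ?_
          refine (Nat.choose_le_pow _ _).trans (Nat.pow_le_pow_left ?_ d)
          have h1 : D - j ≤ D := Nat.sub_le D j
          have h2 : d ≤ d * D := Nat.le_mul_of_pos_right d hD
          calc d + (D - j) ≤ d * D + D := by omega
            _ = (d + 1) * D := by ring
    _ = (d + 1) ^ d * D ^ (d + 1) := by
          rw [Finset.sum_const, Finset.card_range, smul_eq_mul, mul_pow]
          ring

/-- **Combinatorics of the Siegel count.** (1) The total-degree window
`{n : Fin d →₀ ℕ | ∑ j, n j < N}` (the CONDITIONS) is finite with at most `N ^ d` elements.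
(2) The number of UNKNOWNS `∑_{j<D} #Sym (Fin (d+1)) (D-j) = ∑_{j<D} C(d + (D-j), d)` (monomials of
degree `D - j` in `d + 1` variables, summed over `j < D`) is `≥ 1` and of exact order `D^(d+1)`:
with `cβ = 1 / (2^(d+1) d!)` and `cβ' = (d+1)^d` one has `cβ D^(d+1) ≤ #unknowns ≤ cβ' D^(d+1)` for
all `D ≥ 1` (lower bound: the `⌊D/2⌋ + 1 ≥ D/2` terms with `j ≤ D/2` are each
`≥ C(d + ⌈D/2⌉, d) ≥ (⌈D/2⌉ + 1)^d / d! ≥ (D/2)^d / d!` by `Nat.pow_le_choose`; upper bound: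
`Nat.choose_le_pow`). [folklore] -/
theorem stub_counts (d : ℕ) :
    (∀ N : ℕ, {n : Fin d →₀ ℕ | ∑ j, n j < N}.Finite ∧ {n : Fin d →₀ ℕ | ∑ j, n j < N}.ncard ≤ N ^ d) ∧
    ∃ cβ cβ' : ℝ, 0 < cβ ∧ ∀ D : ℕ, 1 ≤ D →
      1 ≤ ∑ j ∈ Finset.range D, Fintype.card (Sym (Fin (d + 1)) (D - j)) ∧
      cβ * (D : ℝ) ^ (d + 1) ≤ ((∑ j ∈ Finset.range D, Fintype.card (Sym (Fin (d + 1)) (D - j)) : ℕ) : ℝ) ∧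
      ((∑ j ∈ Finset.range D, Fintype.card (Sym (Fin (d + 1)) (D - j)) : ℕ) : ℝ) ≤ cβ' * (D : ℝ) ^ (d + 1) := by
  refine ⟨fun N => cnt_window d N, 1 / (2 ^ (d + 1) * (d.factorial : ℝ)),
    (((d + 1) ^ d : ℕ) : ℝ), by positivity, ?_⟩
  intro D hD
  rw [cnt_sum_eq]
  obtain ⟨H, K, hHK, hH, hK⟩ : ∃ H K : ℕ, H + K = D ∧ D ≤ 2 * H + 1 ∧ D ≤ 2 * K :=
    ⟨D / 2, D - D / 2, by omega, by omega, by omega⟩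
  have hL := cnt_sum_lower d D H (by omega)
  rw [show D - H = K by omega] at hL
  have hU := cnt_sum_upper d D hD
  refine ⟨?_, ?_, ?_⟩
  · have hpos : 0 < (H + 1) * (d + K).choose d := Nat.mul_pos (Nat.succ_pos H) (Nat.choose_pos (by omega))
    omega
  · have hH1 : (D : ℝ) / 2 ≤ ((H + 1 : ℕ) : ℝ) := by
      have : (D : ℝ) ≤ 2 * (H : ℝ) + 1 := by exact_mod_cast hH
      push_cast
      linarith
    have hK1 : (D : ℝ) / 2 ≤ ((K + 1 : ℕ) : ℝ) := by
      have : (D : ℝ) ≤ 2 * (K : ℝ) := by exact_mod_cast hK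
      push_cast
      linarith
    have h2 : ((D : ℝ) / 2) ^ d / (d.factorial : ℝ) ≤ ((d + K).choose d : ℝ) := by
      have key := Nat.pow_le_choose (α := ℝ) d (d + K)
      rw [show d + K + 1 - d = K + 1 by omega] at key
      exact le_trans (by gcongr) key
    calc 1 / (2 ^ (d + 1) * (d.factorial : ℝ)) * (D : ℝ) ^ (d + 1)
          = (D : ℝ) / 2 * (((D : ℝ) / 2) ^ d / (d.factorial : ℝ)) := by
            rw [div_pow, pow_succ, pow_succ]
            ring
      _ ≤ ((H + 1 : ℕ) : ℝ) * ((d + K).choose d : ℝ) :=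
            mul_le_mul hH1 h2 (by positivity) (by positivity)
      _ = (((H + 1) * (d + K).choose d : ℕ) : ℝ) := (Nat.cast_mul _ _).symm
      _ ≤ ((∑ j ∈ Finset.range D, (d + (D - j)).choose d : ℕ) : ℝ) := Nat.cast_le.mpr hL
  · calc ((∑ j ∈ Finset.range D, (d + (D - j)).choose d : ℕ) : ℝ)
          ≤ (((d + 1) ^ d * D ^ (d + 1) : ℕ) : ℝ) := Nat.cast_le.mpr hU
      _ = (((d + 1) ^ d : ℕ) : ℝ) * (D : ℝ) ^ (d + 1) := by norm_cast

end Summit.Langlands.Langlands.Theorems.HilbertIntegralOverconvergentIsCongruence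

end
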